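import Literature.MathematicalPhysics.QuantumFieldTheory.Balaban1983to89.B1Eq324BenfattoClassSectEMemberRealAdjointAtNode00

/-!
# `Balaban1983to89.B1Eq324BenfattoClassSectEMemberPrecisionDoorOnLambda` — THE (3.24) PRECISION DOOR FOR `dμ_{C̃^{(k)}(Λ; U)}` READS `(QG₁Q*)⁻¹` AND THE
# `J`-TERM ON Λ-BONDS ONLY AND IN PRINT UNITS: p669260 ∕ p673452 with node N06's two kernel readings (R2′) asked between bonds of `Λ` instead of all index
# bonds, and every precision-type letter read with a real scale `λ` (`λ_x = η^{d+1}` at the record — seat n08-d's CHECK-J, def-Y's convention word (v))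
# (seat dag-n08-b gen 33, CLAIM-10; node N08 [Balaban1985UV3], row `h324c`)

statement-level companion of published sources with citation tags; every declaration here is a theorem; nothing here is a claim about the
Yang–Mills mass gap

THE PRINTED LOCUS.  [Balaban1985BackgroundPropagators] (= [B9]) Sect. E p. 428: *"This form is considered on the subspace {B : B = 0 on Λᶜ, …} … B = CB̃ …
⟨C*g, (C*Δ_kC)⁻¹C*g⟩ (3.157)"* — the Gaussian of (3.157) only sees `Δ_k` between bonds of `Λ`; (3.132) p. 422: *"|(QGQ*)⁻¹(y, y′)| ≤ O(1)(L^jη)⁻²(L^{j′}η)^{−d}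
e^{−δ₁d(y,y′)}, y ∈ Λ_j, y′ ∈ Λ_{j′} … and the same for the operator with G₁"* — the kernel bound carries LEVEL prefactors and the scaled distance `d(y, y′)`.
[Balaban1985UV3] (24) p. 262 and pp. 271–272: the cumulant remainder of the Gaussian integration determined by `⟨A, C*Δ_kCA⟩` (row `h324c` of node N08).

WHY THIS MODULE (cell `pub-ymgap`, seat `dag-n08-b` gen 33, CLAIM-10 — a located defect of the seat's own door).  p669260
`eq324_CsDeltaCY_precision_node00_on_unit` (and its record editions p673452 §6–§8) ask the two displayed kernel readings — (R2′a) of `(QG₁Q*)⁻¹(U)` in def-Y's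
unit-ball `siteKernelOfOp` shape and (R2′b) of `a + ⟨D̃⁽²⁾·,J⟩(U)` — between ALL index bonds of NODE 00's carrier with ONE constant and the UNIT distance `|y − y′|`
(`unitDistY`).  Node N06's (3.132) of record (`B9Carve09Thms310to311Hyp.Hyp.ineq3132`) has the level prefactors `len(y)^{−2}·len(y′)^{−d}` and the scaled distance
`(geo9K i).dist`, and the weight `a` is level-banded (`GlobalBand`): there is no uniform constant over all levels.  But only Λ-BONDS (top level, `inΛY_top`) are read:
def-Y's dressed `P_Λ C P_Λ̃` writes into `secΛY` and `P_Λ̃ C* P_Λ` reads `secΛY` only, so `C*Δ_kC = C*·(P_Λ Δ_k P_Λ)·C`.  A SECOND, SCALE defect was certified by seat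
n08-d g31 (CHECK-J, `…ClassSectEMemberJRowScaleAtNode00`): by def-Y's convention word (v) (`Node00.OpsYSectELetters` l.62–79) the flat precision-type letters
`QG1Qinv ∕ aY ∕ D2J ∕ deltaKY ∕ CsDeltaCY` are print's `× η^{−(d+1)}` (`η = L^{−k}`), e.g. on Λ-bonds the weight is `x.w u ∈ [b₀, b₁]·L^{k(d+1)}`, so no member-uniform
`K_J` (nor `B_P`) exists at flat letters either; the repair (r1) is to read every precision-type letter with the scale `λ_x = η^{d+1}` (def-Y's forthcoming named
letters `etaDY ∕ deltaKPY ∕ CsDeltaCPY` are that token).  THIS FILE therefore (i) weakens the door's (R2′) to bonds `u, v ∈ Λ` and (ii) reads `(QG₁Q*)⁻¹(U)`,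
`a + ⟨D̃⁽²⁾·,J⟩(U)` and `C*Δ_kC` multiplied by an ARBITRARY real scalar `λ` (generic door; `λ := ((L^k)⁻¹)^{d+1}` inline at the v8 record, `= etaDY x` by `rfl` once
named) — nothing else changes — by running p669260's composition with the Λ-TRUNCATED PRINT-UNIT letters `P′ := P_Λ (λ(QG₁Q*)⁻¹(U)) P_Λ`,
`J′ := P_Λ (λ(a + ⟨D̃⁽²⁾·,J⟩(U))) P_Λ` (operator level, inside the proof; no record modified, no definition): they inherit β-self-adjointness, their kernel readings on
all bonds ARE the Λ-rows (zero elsewhere), and `𝕄_ι(λ·C*Δ_kC) = Eᵀ(𝕄(P′) − 𝕄(J′))E`; the conclusion is (3.24) for `𝒩(0, 𝕄_ι(λ·C*Δ_kC)⁻¹)` — print's unit-lattice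
`dμ_{C̃^{(k)}}` at `λ = η^{d+1}`.  The remaining junction to N06's numbered row is a TOP-LEVEL geometry dictionary (`(geo9K i).dist`, `.len` on `inΛY` bonds versus
`unitDistY`) — NODE 00 ∕ N06 vocabulary, not taken here; the `U = 1` 𝒥-row in print units (`K_J := b₁`) is seat n08-d's INTENT-86.

WHAT IS PROVED (standard axioms; no `sorry`; no definition).
* §1 (generic fibre, def-Y's letters at a member): `sum_pairing_secY` (`P_S` is β-self-adjoint over the carrier for any real pairing on the fibre) ·
  `selfAdjoint_secY_sandwich` · `secY_sandwich_single_apply` (`(P_S T P_S)(δ_v ⊗ E)(u) = [u ∈ S][v ∈ S](T(δ_v ⊗ E))(u)`) · ★ `norm_secY_sandwich_single_le` (the reading of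
  `P_S T P_S` on all bonds from the reading of `T` on `S`-bonds) · `selfAdjoint_real_smul` · ★ `CsDeltaCY_eq_secΛY` (`C*Δ_kC = elimCtΛY·(P′ − J′)·elimCΛY`) ·
  `restrictScalars_CsDeltaCY_eq_comp_secΛY` · ★★ `coordMatrix_CsDeltaCY_eq_sandwich_secΛY` · ★ `smul_CsDeltaCY_eq_secΛY` ∕ `restrictScalars_smul_CsDeltaCY_eq_comp_secΛY` ∕
  ★★ `coordMatrix_smul_CsDeltaCY_eq_sandwich_secΛY` (the same for `λ·C*Δ_kC` with `P′, J′` the Λ-truncations of `λ(QG₁Q*)⁻¹`, `λ(a + ⟨D̃⁽²⁾·,J⟩)`).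
* §2 ★★★ `eq324_CsDeltaCY_precision_node00_onΛ_on_unit` — p669260's door (scalars first; every `η ∈ (0,1]`, member, letters, background, and NOW a real scale `λ`,
  symmetric `β` with an orthonormal basis, injective `ι : σ → Λ̃`; (R1′)(R3′)(R4′) unchanged) with (R2′a)(R2′b) asked for `λ(QG₁Q*)⁻¹(U)`, `λ(a + ⟨D̃⁽²⁾·,J⟩(U))` between
  `inΛY` bonds only, (R5′) for `λ·C*Δ_kC`, conclusion for `𝒩(0, 𝕄_ι(λ·C*Δ_kC)⁻¹)`; one `example`.
* §3 ★★★ `eq324_CsDeltaCY_precision_ofRecordTC_trBasis_onΛ_on_unit` (p673452 §6 at the record fibre `M_N(ℂ)`, (R2′)|_Λ, scale `λ`) · ★★★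
  `eq324_CsDeltaCY_precision_opsYOfRecordV8E_trBasis_of_plaqSmall_onΛ_on_unit` (p673452 §8: NODE 00's v8 instance of record under print's small curvature (3.35), every
  NODE-00-letter row a theorem — (R1′) def-Y's symmetry theorems, (R3′) reality, (R4′) seat n08-d's p672585, pivot units def-Y's axial gauge, frame constants 1 — with
  (R2′)|_Λ and the PRINT-UNIT scale `λ_x := ((L^{x.k})⁻¹)^{d+1} = η^{d+1}` on `(QG₁Q*)⁻¹`, `a + ⟨D̃⁽²⁾·,J⟩`, `C*Δ_kC`).
HONEST SCOPE.  Count-neutral finite-dimensional algebra and compositions BY NAME; a WEAKENING of the seat's own displayed hypotheses, nothing of node N06 asserted; the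
top-level geometry dictionary, the two readings themselves and `γ₀` (G-B9-09) stay N06 ∕ NODE 00 content, [5]'s reality of `C⁽²⁾(U)`, `D̃⁽²⁾(U)` stays displayed; NORM
DICTIONARY as in p673452 (L²-operator norm on `M_N(ℂ)` here, Hilbert–Schmidt in [B9] p. 390 — the displayed rows are norm-sensitive by `N`-dependent constants); no letter
pinned beyond naming def-Y's v8 instance; the IDENT (NODE 00's `(𝔖 k).μ = 𝒩(0, 𝕄_Λ̃(C*Δ_kC)⁻¹).map Φ`, box, class-II Hamiltonian letters, window `b₁ < b₀`) is NOT made,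
NOT commissioned, NOT claimed; nothing of [Balaban1985UV3], [Balaban1985BackgroundPropagators], [Balaban1985Averaging], [Balaban1984PropagatorsII], [Balaban1982Higgs1] or
[BenfattoEtAl1978] is asserted or discharged; node N08 is NOT discharged; nothing about d = 4, the continuum, OS axioms, a mass gap or the Clay problem.
-/

noncomputable section

open MeasureTheory Finset Matrix

namespace Literature.MathematicalPhysics.QuantumFieldTheory.Balaban1983to89.B1Eq324BenfattoClassSectEMemberPrecisionDoorOnLambda

open Literature.MathematicalPhysics.QuantumFieldTheory
open Literature.MathematicalPhysics.QuantumFieldTheory.Balaban1983to89.B1Eq324BenfattoLemma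
open Literature.MathematicalPhysics.QuantumFieldTheory.Balaban1983to89.B6Ineq2142KLevelV1 (lvl)
open Literature.MathematicalPhysics.QuantumFieldTheory.Balaban1983to89.B9PinMembersKLevelV1 (MemberY)
open Literature.MathematicalPhysics.QuantumFieldTheory.Balaban1983to89.B9PinGeometryKLevelV1 (unitDistY inΛY inΛY_top)
open Literature.MathematicalPhysics.QuantumFieldTheory.Balaban1983to89.Node00
open Literature.MathematicalPhysics.QuantumFieldTheory.Balaban1983to89.B1Eq324BenfattoClassSectEMemberCoRead
  (sum_pairing_single coordMatrix_symm_of_selfAdjoint coercive_coordMatrix kernelReading_homog_of_ball abs_coordMatrix_le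
    norm_le_of_iSup_closedBall_le deltaY_eq_single)
open Literature.MathematicalPhysics.QuantumFieldTheory.Balaban1983to89.B1Eq324BenfattoClassSectEMemberCoReadProduct
  (orth_of_repr coordMatrix_sandwich coordMatrix_sub locality_coord_of_op colMass_coord_of_op)
open Literature.MathematicalPhysics.QuantumFieldTheory.Balaban1983to89.B1Eq324BenfattoClassSectEMemberAtNode00 (eq324_sectEPrecision_node00_on_unit)

variable {d ℓ : ℕ} {hd : 1 ≤ d + 1} {hL : Odd (ℓ + 1) ∧ 1 < ℓ + 1} {w₀ w₁ : ℝ} {Mstar : ℕ}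

/-! ## §1  The Λ-truncated letters `P′ := P_Λ (QG₁Q*)⁻¹ P_Λ`, `J′ := P_Λ (a + ⟨D̃⁽²⁾·,J⟩) P_Λ`: `C*Δ_kC = C*·(P′ − J′)·C`, self-adjointness, kernel readings -/

section Truncation

variable {𝔸 : Type} [NormedRing 𝔸] [NormedAlgebra ℂ 𝔸] [CompleteSpace 𝔸]
variable {x : MemberY d ℓ hd hL w₀ w₁ Mstar} {𝔏 : CovLettersY 𝔸 x} {𝔢 : SectELettersY 𝔸 x}

omit [CompleteSpace 𝔸] in
/-- `P_S` is β-self-adjoint over the carrier for ANY real pairing `β` on the fibre (it is a pointwise `0∕1` mask). [cite: Balaban1985BackgroundPropagators, p.428 («B = 0 on Λᶜ»), bookkeeping] -/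
theorem sum_pairing_secY (β : 𝔸 →ₗ[ℝ] 𝔸 →ₗ[ℝ] ℝ) (S : IBondY x.toKIdx → Prop) (Φ Ψ : IBondY x.toKIdx → 𝔸) :
    ∑ u, β (Ψ u) (secY 𝔸 S Φ u) = ∑ u, β (secY 𝔸 S Ψ u) (Φ u) := by
  refine Finset.sum_congr rfl fun u _ => ?_
  by_cases h : S u
  · rw [secY_apply_of h, secY_apply_of h]
  · rw [secY_apply_of_not h, secY_apply_of_not h, map_zero, map_zero, LinearMap.zero_apply]

omit [CompleteSpace 𝔸] in
/-- a `P_S`-sandwich of a β-self-adjoint letter is β-self-adjoint. [cite: Balaban1985BackgroundPropagators, (3.156) p.428, Thm 3.11 p.416, bookkeeping] -/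
theorem selfAdjoint_secY_sandwich (β : 𝔸 →ₗ[ℝ] 𝔸 →ₗ[ℝ] ℝ) (S : IBondY x.toKIdx → Prop) (T : Module.End ℂ (IBondY x.toKIdx → 𝔸))
    (hT : ∀ Φ Ψ : IBondY x.toKIdx → 𝔸, ∑ u, β (Ψ u) ((T.restrictScalars ℝ) Φ u) = ∑ u, β ((T.restrictScalars ℝ) Ψ u) (Φ u))
    (Φ Ψ : IBondY x.toKIdx → 𝔸) :
    ∑ u, β (Ψ u) (((secY 𝔸 S * T * secY 𝔸 S).restrictScalars ℝ) Φ u) = ∑ u, β (((secY 𝔸 S * T * secY 𝔸 S).restrictScalars ℝ) Ψ u) (Φ u) := by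
  simp only [LinearMap.restrictScalars_apply, Module.End.mul_apply] at hT ⊢
  rw [sum_pairing_secY, hT, sum_pairing_secY]

omit [CompleteSpace 𝔸] in
/-- **A `P_Λ`-SANDWICH APPLIED TO A BOND DELTA**: `(P_Λ T P_Λ)(δ_v ⊗ E)(u) = [u ∈ Λ][v ∈ Λ]·(T(δ_v ⊗ E))(u)`. [cite: Balaban1985BackgroundPropagators, (3.156) p.428, bookkeeping] -/
theorem secY_sandwich_single_apply [DecidableEq (IBondY x.toKIdx)] (S : IBondY x.toKIdx → Prop) [DecidablePred S]
    (T : Module.End ℂ (IBondY x.toKIdx → 𝔸)) (u v : IBondY x.toKIdx) (E : 𝔸) :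
    (secY 𝔸 S * T * secY 𝔸 S) (Pi.single v E) u = if S u ∧ S v then T (Pi.single v E) u else 0 := by
  rw [Module.End.mul_apply, Module.End.mul_apply]
  have hv : secY 𝔸 S (Pi.single v E : IBondY x.toKIdx → 𝔸) = if S v then (Pi.single v E : IBondY x.toKIdx → 𝔸) else 0 := by
    funext w
    by_cases hSv : S v
    · rw [if_pos hSv]
      by_cases hw : S w
      · rw [secY_apply_of hw]
      · have hne : w ≠ v := by rintro rfl; exact hw hSv
        rw [secY_apply_of_not hw, Pi.single_eq_of_ne hne]
    · rw [if_neg hSv, Pi.zero_apply]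
      by_cases hw : S w
      · have hne : w ≠ v := by rintro rfl; exact hSv hw
        rw [secY_apply_of hw, Pi.single_eq_of_ne hne]
      · rw [secY_apply_of_not hw]
  rw [hv]
  by_cases hu : S u
  · rw [secY_apply_of hu]
    by_cases hSv : S v
    · rw [if_pos hSv, if_pos ⟨hu, hSv⟩]
    · rw [if_neg hSv, map_zero, Pi.zero_apply, if_neg (fun h => hSv h.2)]
  · rw [secY_apply_of_not hu, if_neg (fun h => hu h.1)]

omit [CompleteSpace 𝔸] in
/-- **THE KERNEL READING OF A `P_Λ`-SANDWICH FROM THE READING ON Λ-BONDS**: if `‖(T(δ_v ⊗ E))(u)‖ ≤ K‖E‖e^{−δρ(u,v)}` for `u, v ∈ Λ`, then the same bound holds for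
`P_Λ T P_Λ` on ALL bonds (`K ≥ 0`). [cite: Balaban1985BackgroundPropagators, (3.132) p.422, (3.156) p.428, bookkeeping] -/
theorem norm_secY_sandwich_single_le [DecidableEq (IBondY x.toKIdx)] (S : IBondY x.toKIdx → Prop) (T : Module.End ℂ (IBondY x.toKIdx → 𝔸))
    {K δ : ℝ} (hK : 0 ≤ K) (ρ : IBondY x.toKIdx → IBondY x.toKIdx → ℝ)
    (hT : ∀ (u v : IBondY x.toKIdx) (E : 𝔸), S u → S v → ‖T (Pi.single v E) u‖ ≤ K * ‖E‖ * Real.exp (-(δ * ρ u v)))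
    (u v : IBondY x.toKIdx) (E : 𝔸) :
    ‖((secY 𝔸 S * T * secY 𝔸 S).restrictScalars ℝ) (Pi.single v E) u‖ ≤ K * ‖E‖ * Real.exp (-(δ * ρ u v)) := by
  classical
  rw [LinearMap.restrictScalars_apply, secY_sandwich_single_apply]
  split_ifs with h
  · exact hT u v E h.1 h.2
  · rw [norm_zero]; positivity

/-- ★ **`C*Δ_kC = C*·(P′ − J′)·C` WITH THE Λ-TRUNCATED LETTERS** `P′ := P_Λ (QG₁Q*)⁻¹(U) P_Λ`, `J′ := P_Λ (a + ⟨D̃⁽²⁾·,J⟩(U)) P_Λ` (def-Y's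
`CsDeltaCY = elimCtΛY · Δ_k · elimCΛY` with `elimCtΛY · P_Λ = elimCtΛY`, `P_Λ · elimCΛY = elimCΛY`: `C*` reads and `C` writes Λ-bonds only).
[cite: Balaban1985BackgroundPropagators, (3.156)–(3.157) p.428 («B = 0 on Λᶜ … B = CB̃»), bookkeeping] -/
theorem CsDeltaCY_eq_secΛY (U : CfgY 𝔸 x.toKIdx) :
    CsDeltaCY x 𝔏 𝔢 U =
      elimCtΛY x 𝔢 U * (secΛY 𝔸 x * 𝔏.QG1Qinv U * secΛY 𝔸 x - secΛY 𝔸 x * (aY x.toKIdx + 𝔢.D2J U) * secΛY 𝔸 x) * elimCΛY x 𝔢 U := by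
  have hC : secΛY 𝔸 x * elimCΛY x 𝔢 U = elimCΛY x 𝔢 U := by
    show secΛY 𝔸 x * (secΛY 𝔸 x * 𝔢.elimC U * secY 𝔸 𝔢.LamT) = secΛY 𝔸 x * 𝔢.elimC U * secY 𝔸 𝔢.LamT
    rw [← mul_assoc, ← mul_assoc, secΛY_idem]
  have hCt : elimCtΛY x 𝔢 U * secΛY 𝔸 x = elimCtΛY x 𝔢 U :=
    mul_secΛY_mul_secΛY x (secY 𝔸 𝔢.LamT * 𝔢.elimCt U)
  calc CsDeltaCY x 𝔏 𝔢 U = elimCtΛY x 𝔢 U * deltaKY x 𝔏 𝔢 U * elimCΛY x 𝔢 U := rfl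
    _ = (elimCtΛY x 𝔢 U * secΛY 𝔸 x) * deltaKY x 𝔏 𝔢 U * (secΛY 𝔸 x * elimCΛY x 𝔢 U) := by rw [hCt, hC]
    _ = elimCtΛY x 𝔢 U * (secΛY 𝔸 x * deltaKY x 𝔏 𝔢 U * secΛY 𝔸 x) * elimCΛY x 𝔢 U := by simp only [mul_assoc]
    _ = _ := by rw [deltaKY_apply, sub_sub, mul_sub, sub_mul]

/-- the same as ℝ-linear composites (the shape p669260 `coordMatrix_sandwich` consumes). [cite: Balaban1985BackgroundPropagators, (3.156)–(3.157) p.428, bookkeeping] -/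
theorem restrictScalars_CsDeltaCY_eq_comp_secΛY (U : CfgY 𝔸 x.toKIdx) :
    (CsDeltaCY x 𝔏 𝔢 U).restrictScalars ℝ =
      (elimCtΛY x 𝔢 U).restrictScalars ℝ ∘ₗ
        ((secΛY 𝔸 x * 𝔏.QG1Qinv U * secΛY 𝔸 x).restrictScalars ℝ -
          (secΛY 𝔸 x * (aY x.toKIdx + 𝔢.D2J U) * secΛY 𝔸 x).restrictScalars ℝ) ∘ₗ
        (elimCΛY x 𝔢 U).restrictScalars ℝ := by
  rw [CsDeltaCY_eq_secΛY]
  apply LinearMap.ext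
  intro Φ
  simp only [LinearMap.restrictScalars_apply, LinearMap.comp_apply, LinearMap.sub_apply, Module.End.mul_apply]

omit [CompleteSpace 𝔸] in
/-- a REAL multiple of a β-self-adjoint letter is β-self-adjoint (the print-unit letters `η^{d+1}·Δ_k` of def-Y's convention word (v) inherit (R1′)).
[cite: Balaban1985BackgroundPropagators, (3.156) p.428, Thm 3.11 p.416, bookkeeping] -/
theorem selfAdjoint_real_smul (β : 𝔸 →ₗ[ℝ] 𝔸 →ₗ[ℝ] ℝ) (T : Module.End ℂ (IBondY x.toKIdx → 𝔸)) (r : ℝ)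
    (hT : ∀ Φ Ψ : IBondY x.toKIdx → 𝔸, ∑ u, β (Ψ u) ((T.restrictScalars ℝ) Φ u) = ∑ u, β ((T.restrictScalars ℝ) Ψ u) (Φ u))
    (Φ Ψ : IBondY x.toKIdx → 𝔸) :
    ∑ u, β (Ψ u) ((((r : ℂ) • T).restrictScalars ℝ) Φ u) = ∑ u, β ((((r : ℂ) • T).restrictScalars ℝ) Ψ u) (Φ u) := by
  simp only [LinearMap.restrictScalars_apply, LinearMap.smul_apply, Pi.smul_apply, Complex.coe_smul, map_smul, LinearMap.smul_apply,
    smul_eq_mul] at hT ⊢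
  rw [← Finset.mul_sum, ← Finset.mul_sum, hT]

/-- ★ **THE PRINT-UNIT LETTER `λ·C*Δ_kC = C*·(P_Λ(λ·(QG₁Q*)⁻¹)P_Λ − P_Λ(λ·(a + ⟨D̃⁽²⁾·,J⟩))P_Λ)·C`** for any scalar `λ` (def-Y's convention word (v): the flat precision-type
letters are print's `× η^{−(d+1)}`; seat n08-d's CHECK-J ∕ (r1): read them scaled by `λ_x = η^{d+1}`). [cite: Balaban1985BackgroundPropagators, (3.156)–(3.157) p.428, (3.16) p.393 (unit conventions), bookkeeping] -/
theorem smul_CsDeltaCY_eq_secΛY (U : CfgY 𝔸 x.toKIdx) (c : ℂ) :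
    c • CsDeltaCY x 𝔏 𝔢 U =
      elimCtΛY x 𝔢 U * (secΛY 𝔸 x * (c • 𝔏.QG1Qinv U) * secΛY 𝔸 x - secΛY 𝔸 x * (c • (aY x.toKIdx + 𝔢.D2J U)) * secΛY 𝔸 x) *
        elimCΛY x 𝔢 U := by
  rw [CsDeltaCY_eq_secΛY, ← smul_mul_assoc, ← mul_smul_comm, smul_sub, ← smul_mul_assoc, ← mul_smul_comm, ← smul_mul_assoc, ← mul_smul_comm]

/-- the same as ℝ-linear composites. [cite: Balaban1985BackgroundPropagators, (3.156)–(3.157) p.428, bookkeeping] -/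
theorem restrictScalars_smul_CsDeltaCY_eq_comp_secΛY (U : CfgY 𝔸 x.toKIdx) (c : ℂ) :
    (c • CsDeltaCY x 𝔏 𝔢 U).restrictScalars ℝ =
      (elimCtΛY x 𝔢 U).restrictScalars ℝ ∘ₗ
        ((secΛY 𝔸 x * (c • 𝔏.QG1Qinv U) * secΛY 𝔸 x).restrictScalars ℝ -
          (secΛY 𝔸 x * (c • (aY x.toKIdx + 𝔢.D2J U)) * secΛY 𝔸 x).restrictScalars ℝ) ∘ₗ
        (elimCΛY x 𝔢 U).restrictScalars ℝ := by
  rw [smul_CsDeltaCY_eq_secΛY]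
  apply LinearMap.ext
  intro Φ
  simp only [LinearMap.restrictScalars_apply, LinearMap.comp_apply, LinearMap.sub_apply, Module.End.mul_apply]

variable {κ : Type} [Fintype κ] [DecidableEq κ] {σ : Type} [Fintype σ]

/-- ★★ **`𝕄_ι(C*Δ_kC) = Eᵀ·(𝕄(P′) − 0·1 − 𝕄(J′))·E` WITH THE Λ-TRUNCATED LETTERS** (p669260 `coordMatrix_CsDeltaCY_eq_sandwich` with `P′, J′` for `P, J`), given
the β-adjointness of `elimCΛY ∕ elimCtΛY` over the carrier. [cite: Balaban1985BackgroundPropagators, (3.156)–(3.157) p.428; Balaban1984PropagatorsII, p.250, dictionary] -/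
theorem coordMatrix_CsDeltaCY_eq_sandwich_secΛY [DecidableEq (IBondY x.toKIdx)] (U : CfgY 𝔸 x.toKIdx) (β : 𝔸 →ₗ[ℝ] 𝔸 →ₗ[ℝ] ℝ)
    (hβ : ∀ v w, β v w = β w v) (b : Module.Basis κ ℝ 𝔸) (hb : ∀ (v : 𝔸) (c : κ), b.repr v c = β (b c) v) (ι : σ → IBondY x.toKIdx)
    (hadj : ∀ Φ Ψ : IBondY x.toKIdx → 𝔸, ∑ u, β (Ψ u) (((elimCΛY x 𝔢 U).restrictScalars ℝ) Φ u) =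
      ∑ u, β (((elimCtΛY x 𝔢 U).restrictScalars ℝ) Ψ u) (Φ u)) :
    (Matrix.of fun p q : σ × κ => β (b p.2) (((CsDeltaCY x 𝔏 𝔢 U).restrictScalars ℝ) (Pi.single (ι q.1) (b q.2)) (ι p.1))) =
      (Matrix.of fun (v : IBondY x.toKIdx × κ) (q : σ × κ) =>
          β (b v.2) (((elimCΛY x 𝔢 U).restrictScalars ℝ) (Pi.single (ι q.1) (b q.2)) v.1))ᵀ *
        ((Matrix.of fun u v : IBondY x.toKIdx × κ =>
            β (b u.2) (((secΛY 𝔸 x * 𝔏.QG1Qinv U * secΛY 𝔸 x).restrictScalars ℝ) (Pi.single (id v.1) (b v.2)) (id u.1))) -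
          (0 : ℝ) • (1 : Matrix (IBondY x.toKIdx × κ) (IBondY x.toKIdx × κ) ℝ) -
          (Matrix.of fun u v : IBondY x.toKIdx × κ =>
            β (b u.2) (((secΛY 𝔸 x * (aY x.toKIdx + 𝔢.D2J U) * secΛY 𝔸 x).restrictScalars ℝ) (Pi.single (id v.1) (b v.2)) (id u.1)))) *
        (Matrix.of fun (v : IBondY x.toKIdx × κ) (q : σ × κ) =>
          β (b v.2) (((elimCΛY x 𝔢 U).restrictScalars ℝ) (Pi.single (ι q.1) (b q.2)) v.1)) := by
  rw [← coordMatrix_sub β b, restrictScalars_CsDeltaCY_eq_comp_secΛY U]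
  exact coordMatrix_sandwich β b hβ hb _ _ _ hadj ι

/-- ★★ **`𝕄_ι(λ·C*Δ_kC) = Eᵀ·(𝕄(P_Λ λ(QG₁Q*)⁻¹ P_Λ) − 0·1 − 𝕄(P_Λ λ(a + ⟨D̃⁽²⁾·,J⟩) P_Λ))·E`** — the print-unit, Λ-truncated sandwich.
[cite: Balaban1985BackgroundPropagators, (3.156)–(3.157) p.428; Balaban1984PropagatorsII, p.250, dictionary] -/
theorem coordMatrix_smul_CsDeltaCY_eq_sandwich_secΛY [DecidableEq (IBondY x.toKIdx)] (U : CfgY 𝔸 x.toKIdx) (c : ℂ) (β : 𝔸 →ₗ[ℝ] 𝔸 →ₗ[ℝ] ℝ)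
    (hβ : ∀ v w, β v w = β w v) (b : Module.Basis κ ℝ 𝔸) (hb : ∀ (v : 𝔸) (c' : κ), b.repr v c' = β (b c') v) (ι : σ → IBondY x.toKIdx)
    (hadj : ∀ Φ Ψ : IBondY x.toKIdx → 𝔸, ∑ u, β (Ψ u) (((elimCΛY x 𝔢 U).restrictScalars ℝ) Φ u) =
      ∑ u, β (((elimCtΛY x 𝔢 U).restrictScalars ℝ) Ψ u) (Φ u)) :
    (Matrix.of fun p q : σ × κ => β (b p.2) (((c • CsDeltaCY x 𝔏 𝔢 U).restrictScalars ℝ) (Pi.single (ι q.1) (b q.2)) (ι p.1))) =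
      (Matrix.of fun (v : IBondY x.toKIdx × κ) (q : σ × κ) =>
          β (b v.2) (((elimCΛY x 𝔢 U).restrictScalars ℝ) (Pi.single (ι q.1) (b q.2)) v.1))ᵀ *
        ((Matrix.of fun u v : IBondY x.toKIdx × κ =>
            β (b u.2) (((secΛY 𝔸 x * (c • 𝔏.QG1Qinv U) * secΛY 𝔸 x).restrictScalars ℝ) (Pi.single (id v.1) (b v.2)) (id u.1))) -
          (0 : ℝ) • (1 : Matrix (IBondY x.toKIdx × κ) (IBondY x.toKIdx × κ) ℝ) -
          (Matrix.of fun u v : IBondY x.toKIdx × κ =>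
            β (b u.2) (((secΛY 𝔸 x * (c • (aY x.toKIdx + 𝔢.D2J U)) * secΛY 𝔸 x).restrictScalars ℝ) (Pi.single (id v.1) (b v.2)) (id u.1)))) *
        (Matrix.of fun (v : IBondY x.toKIdx × κ) (q : σ × κ) =>
          β (b v.2) (((elimCΛY x 𝔢 U).restrictScalars ℝ) (Pi.single (ι q.1) (b q.2)) v.1)) := by
  rw [← coordMatrix_sub β b, restrictScalars_smul_CsDeltaCY_eq_comp_secΛY U c]
  exact coordMatrix_sandwich β b hβ hb _ _ _ hadj ι

end Truncation

/-! ## §2  p669260's precision door with (R2′) asked on Λ-bonds only -/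

section DoorOnLambda

variable {d : ℕ}

/-- ★★★ **[Balaban1982Higgs1] (3.24) FOR `dμ_{C̃^{(k)}(Λ; U)}` AT NODE 00's NAMED LETTERS, PRECISION CURRENCY — (R2′) ON Λ-BONDS ONLY, PRINT-UNIT SCALE `λ`.**
p669260 `eq324_CsDeltaCY_precision_node00_on_unit` (same scalars-first binder list; a real scale `λ` bound with the background; conclusion for `𝒩(0, 𝕄_ι(λ·C*Δ_kC)⁻¹)`)
EXCEPT that the two kernel readings (R2′a) of `λ(QG₁Q*)⁻¹(U)` and (R2′b) of `λ(a + ⟨D̃⁽²⁾·,J⟩(U))` are asked between bonds `u, v ∈ Λ` only (`inΛY x u → inΛY x v → …`)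
and (R5′) reads `λ·C*Δ_kC`: since `C*` reads and `C` writes Λ-bonds only,
`𝕄_ι(C*Δ_kC) = Eᵀ(𝕄(P′) − 𝕄(J′))E` with the Λ-truncated letters `P′ := P_Λ (QG₁Q*)⁻¹ P_Λ`, `J′ := P_Λ (a + ⟨D̃⁽²⁾·,J⟩) P_Λ` (§1), which inherit β-self-adjointness
and whose kernel readings on ALL bonds are the Λ-rows (zero elsewhere).  This is the shape node N06's (3.132) delivers: its prefactors `len(y)^{−2} len(y′)^{−d}`
and scaled distance are constants of the TOP level on `Λ` (`inΛY_top`). [cite: Balaban1985BackgroundPropagators, (3.132) p.422, (3.155)–(3.158) pp.427–428, Thm 3.11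
p.416; Balaban1984PropagatorsII, p.250; Balaban1985UV3, (24) p.262, (58) p.270, pp.271–272; Balaban1982Higgs1, (3.24) p.616; BenfattoEtAl1978, Lemma (4.5)–(4.7) p.152
(class form; bent window, presentation and coordinates ours)] -/
theorem eq324_CsDeltaCY_precision_node00_onΛ_on_unit (κ : Type) [Fintype κ] [DecidableEq κ] [Nonempty κ] {γ₀ BP KJ δ r m cβ ne : ℝ}
    (hγ₀ : 0 < γ₀) (hBP : 0 ≤ BP) (hKJ : 0 ≤ KJ) (hδ : 0 < δ) (hm : 0 ≤ m) (hcβ : 0 ≤ cβ) (hne : 0 ≤ ne) (t D : ℕ) {ϰ : ℝ} (hϰ : 0 < ϰ)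
    {p₀ σ' c κ' : ℝ} (hp₀ : 2 / 3 < p₀) (hσ : 0 < σ') (hc : 0 ≤ c) (hκ : 0 < κ') (hκσ : κ' < σ' * (t + 1)) :
    ∃ b₁ : ℝ, ∀ b₀ : ℝ, b₁ < b₀ → ∃ C : ℝ, 0 ≤ C ∧ ∀ η : ℝ, 0 < η → η ≤ 1 →
      ∀ {ℓ : ℕ} {hd : 1 ≤ d + 1} {hL : Odd (ℓ + 1) ∧ 1 < ℓ + 1} {w₀ w₁ : ℝ} {Mstar : ℕ} (x : MemberY d ℓ hd hL w₀ w₁ Mstar)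
        [DecidableEq (IBondY x.toKIdx)] {𝔸 : Type} [NormedRing 𝔸] [NormedAlgebra ℂ 𝔸] [CompleteSpace 𝔸] [FiniteDimensional ℝ 𝔸]
        (𝔏 : CovLettersY 𝔸 x) (𝔢 : SectELettersY 𝔸 x) (U : CfgY 𝔸 x.toKIdx) (lam : ℝ)
        (β : 𝔸 →ₗ[ℝ] 𝔸 →ₗ[ℝ] ℝ), (∀ v w, β v w = β w v) →
      ∀ (b : Module.Basis κ ℝ 𝔸), (∀ (v : 𝔸) (c' : κ), b.repr v c' = β (b c') v) → (∀ (c' : κ) (v : 𝔸), |β (b c') v| ≤ cβ * ‖v‖) →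
        (∀ c', ‖b c'‖ ≤ ne) →
      ∀ {σ : Type} [Fintype σ] [DecidableEq σ] [Nonempty σ] (ι : σ → IBondY x.toKIdx), Function.Injective ι → (∀ s, 𝔢.LamT (ι s)) →
        (∀ Φ Ψ : IBondY x.toKIdx → 𝔸, ∑ u, β (Ψ u) (((𝔏.QG1Qinv U).restrictScalars ℝ) Φ u) =
          ∑ u, β (((𝔏.QG1Qinv U).restrictScalars ℝ) Ψ u) (Φ u)) →
        (∀ Φ Ψ : IBondY x.toKIdx → 𝔸, ∑ u, β (Ψ u) (((aY x.toKIdx + 𝔢.D2J U).restrictScalars ℝ) Φ u) =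
          ∑ u, β (((aY x.toKIdx + 𝔢.D2J U).restrictScalars ℝ) Ψ u) (Φ u)) →
        (∀ u v : IBondY x.toKIdx, inΛY x u → inΛY x v →
          (⨆ E : BallY 𝔸, ‖((lam : ℂ) • 𝔏.QG1Qinv U) (deltaY v (E : 𝔸)) u‖) ≤ BP * Real.exp (-(δ * unitDistY x u v))) →
        (∀ (u v : IBondY x.toKIdx) (E : 𝔸), inΛY x u → inΛY x v →
          ‖(((lam : ℂ) • (aY x.toKIdx + 𝔢.D2J U)).restrictScalars ℝ) (Pi.single v E) u‖ ≤ KJ * ‖E‖ * Real.exp (-(δ * unitDistY x u v))) →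
        (∀ Φ Ψ : IBondY x.toKIdx → 𝔸, ∑ u, β (Ψ u) (((elimCΛY x 𝔢 U).restrictScalars ℝ) Φ u) =
          ∑ u, β (((elimCtΛY x 𝔢 U).restrictScalars ℝ) Ψ u) (Φ u)) →
        (∀ (s : σ) (w : 𝔸) (u : IBondY x.toKIdx), elimCΛY x 𝔢 U (Pi.single (ι s) w) u ≠ 0 → unitDistY x u (ι s) ≤ r) →
        (∀ (s : σ) (c' : κ), ∑ u, ‖elimCΛY x 𝔢 U (Pi.single (ι s) (b c')) u‖ ≤ m) →
        (∀ Φ : IBondY x.toKIdx → 𝔸, (∀ u, u ∉ Set.range ι → Φ u = 0) → (∀ u, Φ u ∈ Submodule.span ℝ (Set.range b)) →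
          γ₀ * ∑ u, β (Φ u) (Φ u) ≤ ∑ u, β (Φ u) ((((lam : ℂ) • CsDeltaCY x 𝔏 𝔢 U).restrictScalars ℝ) Φ u)) →
      ∃ (Λ : Finset (B1Eq324BenfattoLemma.Site (d + 1 + (d + 1) + 1))) (e' : σ × κ ≃ ↥Λ),
        ((gaussianFieldOfKernel fun u w => if h : u ∈ Λ ∧ w ∈ Λ then
            ((Matrix.reindex e' e'
              (Matrix.of fun p q : σ × κ =>
                  β (b p.2) ((((lam : ℂ) • CsDeltaCY x 𝔏 𝔢 U).restrictScalars ℝ) (Pi.single (ι q.1) (b q.2)) (ι p.1))))⁻¹ :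
                Matrix ↥Λ ↥Λ ℝ) ⟨u, h.1⟩ ⟨w, h.2⟩ else 0).map
            (fun (z : B1Eq324BenfattoLemma.Site (d + 1 + (d + 1) + 1) → ℝ) (q : σ × κ) =>
              z ((e' q : ↥Λ) : B1Eq324BenfattoLemma.Site (d + 1 + (d + 1) + 1))) =
          gaussianFieldOfKernel fun p q =>
            ((Matrix.of fun p q : σ × κ =>
                β (b p.2) ((((lam : ℂ) • CsDeltaCY x 𝔏 𝔢 U).restrictScalars ℝ) (Pi.single (ι q.1) (b q.2)) (ι p.1)))⁻¹ :
              Matrix (σ × κ) (σ × κ) ℝ) p q) ∧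
        (∀ p : ℝ, 0 ≤ p →
          ((fun (z : B1Eq324BenfattoLemma.Site (d + 1 + (d + 1) + 1) → ℝ) (q : σ × κ) =>
              z ((e' q : ↥Λ) : B1Eq324BenfattoLemma.Site (d + 1 + (d + 1) + 1))) ⁻¹'
              {ω : σ × κ → ℝ | ∀ q, |ω q| ≤ p}) =ᵐ[gaussianFieldOfKernel fun u w => if h : u ∈ Λ ∧ w ∈ Λ then
                ((Matrix.reindex e' e'
                  (Matrix.of fun p q : σ × κ =>
                      β (b p.2) ((((lam : ℂ) • CsDeltaCY x 𝔏 𝔢 U).restrictScalars ℝ) (Pi.single (ι q.1) (b q.2)) (ι p.1))))⁻¹ :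
                    Matrix ↥Λ ↥Λ ℝ) ⟨u, h.1⟩ ⟨w, h.2⟩ else 0]
            smallFieldSet Λ p) ∧
        ∀ (s : ℕ) (I J : Finset (B1Eq324BenfattoLemma.Site (d + 1 + (d + 1) + 1))) (𝔞 : Coef (d + 1 + (d + 1) + 1)),
          I.Nonempty → J ⊆ I → J ⊆ Λ → coefSup s D 𝔞 J ≤ c * η ^ σ' →
          0 < ∫ z, cutoffBoltzmann (hamiltonian s D ϰ 𝔞 J) I (B10.pFun b₀ p₀ η) z ∂(gaussianFieldOfKernel fun u w => if h : u ∈ Λ ∧ w ∈ Λ then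
              ((Matrix.reindex e' e'
                (Matrix.of fun p q : σ × κ =>
                    β (b p.2) ((((lam : ℂ) • CsDeltaCY x 𝔏 𝔢 U).restrictScalars ℝ) (Pi.single (ι q.1) (b q.2)) (ι p.1))))⁻¹ :
                  Matrix ↥Λ ↥Λ ℝ) ⟨u, h.1⟩ ⟨w, h.2⟩ else 0) ∧
            |Real.log (∫ z, cutoffBoltzmann (hamiltonian s D ϰ 𝔞 J) I (B10.pFun b₀ p₀ η) z ∂(gaussianFieldOfKernel fun u w =>
                if h : u ∈ Λ ∧ w ∈ Λ then
                  ((Matrix.reindex e' e'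
                    (Matrix.of fun p q : σ × κ =>
                        β (b p.2) ((((lam : ℂ) • CsDeltaCY x 𝔏 𝔢 U).restrictScalars ℝ) (Pi.single (ι q.1) (b q.2)) (ι p.1))))⁻¹ :
                      Matrix ↥Λ ↥Λ ℝ) ⟨u, h.1⟩ ⟨w, h.2⟩ else 0)) -
              cumulantSum (gaussianFieldOfKernel fun u w => if h : u ∈ Λ ∧ w ∈ Λ then
                  ((Matrix.reindex e' e'
                    (Matrix.of fun p q : σ × κ =>
                        β (b p.2) ((((lam : ℂ) • CsDeltaCY x 𝔏 𝔢 U).restrictScalars ℝ) (Pi.single (ι q.1) (b q.2)) (ι p.1))))⁻¹ :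
                      Matrix ↥Λ ↥Λ ℝ) ⟨u, h.1⟩ ⟨w, h.2⟩ else 0)
                (hamiltonian s D ϰ 𝔞 J) t| ≤ C * η ^ κ' * I.card := by
  have hKP : 0 ≤ cβ * ne * BP := by positivity
  have hKJ' : 0 ≤ cβ * ne * KJ := by positivity
  have hmC : 0 ≤ Fintype.card κ * cβ * m := by positivity
  obtain ⟨b₁, hb₁⟩ := eq324_sectEPrecision_node00_on_unit (d := d) κ hγ₀ hKP hKJ' le_rfl hδ hmC t D hϰ hp₀ hσ hc hκ hκσ (r := r)
  refine ⟨b₁, fun b₀ hb₀ => ?_⟩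
  obtain ⟨C, hC, hE⟩ := hb₁ b₀ hb₀
  refine ⟨C, hC, ?_⟩
  intro η hη hηle ℓ hd hL w₀ w₁ Mstar x _ 𝔸 _ _ _ _ 𝔏 𝔢 U lam β hβ b hb hβn hen σ _ _ _ ι hι hιT hPadj hJadj hProw hJker hCadj hloc hmass hco
  have htop : ∀ s, lvl x.hN x.D x.hk (ι s) = x.k := fun s => inΛY_top (𝔢.LamT_inΛ _ (hιT s))
  have he : ∀ c₁ c₂ : κ, β (b c₁) (b c₂) = if c₁ = c₂ then 1 else 0 := orth_of_repr β b hb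
  -- the Λ-TRUNCATED letters `P′ := P_Λ (QG₁Q*)⁻¹ P_Λ`, `J′ := P_Λ (a + D2J) P_Λ`: self-adjoint, read everywhere from the Λ-rows
  -- the PRINT-UNIT letters `P := λ·(QG₁Q*)⁻¹(U)`, `J := λ·(a + D2J U)` (def-Y's convention word (v), seat n08-d's CHECK-J (r1))
  have hPs := coordMatrix_symm_of_selfAdjoint β b (id : IBondY x.toKIdx → IBondY x.toKIdx)
    ((secΛY 𝔸 x * ((lam : ℂ) • 𝔏.QG1Qinv U) * secΛY 𝔸 x).restrictScalars ℝ) hβ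
    (selfAdjoint_secY_sandwich β (inΛY x) _ (selfAdjoint_real_smul β (𝔏.QG1Qinv U) lam hPadj))
  have hJs := coordMatrix_symm_of_selfAdjoint β b (id : IBondY x.toKIdx → IBondY x.toKIdx)
    ((secΛY 𝔸 x * ((lam : ℂ) • (aY x.toKIdx + 𝔢.D2J U)) * secΛY 𝔸 x).restrictScalars ℝ) hβ
    (selfAdjoint_secY_sandwich β (inΛY x) _ (selfAdjoint_real_smul β (aY x.toKIdx + 𝔢.D2J U) lam hJadj))
  have hPΛ : ∀ (u v : IBondY x.toKIdx) (E : 𝔸), inΛY x u → inΛY x v →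
      ‖((lam : ℂ) • 𝔏.QG1Qinv U) (Pi.single v E) u‖ ≤ BP * ‖E‖ * Real.exp (-(δ * unitDistY x u v)) := by
    intro u v E hu hv
    have hsup : (⨆ E' : ↥(Metric.closedBall (0 : 𝔸) 1), ‖(((lam : ℂ) • 𝔏.QG1Qinv U).restrictScalars ℝ) (Pi.single v (E' : 𝔸)) u‖) ≤
        BP * Real.exp (-(δ * unitDistY x u v)) := by
      have h := hProw u v hu hv
      have hfun : (fun E' : BallY 𝔸 => ‖((lam : ℂ) • 𝔏.QG1Qinv U) (deltaY v (E' : 𝔸)) u‖) =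
          fun E' : ↥(Metric.closedBall (0 : 𝔸) 1) => ‖(((lam : ℂ) • 𝔏.QG1Qinv U).restrictScalars ℝ) (Pi.single v (E' : 𝔸)) u‖ := by
        funext E'; rw [deltaY_eq_single, LinearMap.restrictScalars_apply]
      rw [hfun] at h
      exact h
    have h := kernelReading_homog_of_ball (((lam : ℂ) • 𝔏.QG1Qinv U).restrictScalars ℝ)
      (norm_le_of_iSup_closedBall_le (((lam : ℂ) • 𝔏.QG1Qinv U).restrictScalars ℝ) u v hsup) E
    calc ‖((lam : ℂ) • 𝔏.QG1Qinv U) (Pi.single v E) u‖ = ‖(((lam : ℂ) • 𝔏.QG1Qinv U).restrictScalars ℝ) (Pi.single v E) u‖ := rfl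
      _ ≤ BP * Real.exp (-(δ * unitDistY x u v)) * ‖E‖ := h
      _ = BP * ‖E‖ * Real.exp (-(δ * unitDistY x u v)) := by ring
  have hPker : ∀ (u v : IBondY x.toKIdx) (E : 𝔸),
      ‖((secΛY 𝔸 x * ((lam : ℂ) • 𝔏.QG1Qinv U) * secΛY 𝔸 x).restrictScalars ℝ) (Pi.single (id v) E) (id u)‖ ≤
        BP * ‖E‖ * Real.exp (-(δ * unitDistY x u v)) :=
    fun u v E => norm_secY_sandwich_single_le (inΛY x) ((lam : ℂ) • 𝔏.QG1Qinv U) hBP (unitDistY x) hPΛ u v E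
  have hJker' : ∀ (u v : IBondY x.toKIdx) (E : 𝔸),
      ‖((secΛY 𝔸 x * ((lam : ℂ) • (aY x.toKIdx + 𝔢.D2J U)) * secΛY 𝔸 x).restrictScalars ℝ) (Pi.single (id v) E) (id u)‖ ≤
        KJ * ‖E‖ * Real.exp (-(δ * unitDistY x u v)) :=
    fun u v E => norm_secY_sandwich_single_le (inΛY x) ((lam : ℂ) • (aY x.toKIdx + 𝔢.D2J U)) hKJ (unitDistY x)
      (fun u v E hu hv => hJker u v E hu hv) u v E
  have hP := abs_coordMatrix_le β b (id : IBondY x.toKIdx → IBondY x.toKIdx)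
    ((secΛY 𝔸 x * ((lam : ℂ) • 𝔏.QG1Qinv U) * secΛY 𝔸 x).restrictScalars ℝ) hcβ hBP (unitDistY x) hβn hen hPker
  have hJ := abs_coordMatrix_le β b (id : IBondY x.toKIdx → IBondY x.toKIdx)
    ((secΛY 𝔸 x * ((lam : ℂ) • (aY x.toKIdx + 𝔢.D2J U)) * secΛY 𝔸 x).restrictScalars ℝ) hcβ hKJ (unitDistY x) hβn hen hJker'
  -- the rows of `E`
  have hCr := locality_coord_of_op (𝔢 := 𝔢) U β b ι hloc
  have hC1 := colMass_coord_of_op (𝔢 := 𝔢) U β b ι hcβ hβn hmass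
  -- the γ₀ row of `T := 𝕄_ι(A)`, rewritten as the Λ-truncated sandwich
  have hγ := coercive_coordMatrix β b ι (((lam : ℂ) • CsDeltaCY x 𝔏 𝔢 U).restrictScalars ℝ) he hι hco
  have hsand := coordMatrix_smul_CsDeltaCY_eq_sandwich_secΛY (𝔏 := 𝔏) (𝔢 := 𝔢) U (lam : ℂ) β hβ b hb ι hCadj
  rw [hsand] at hγ
  have h := hE η hη hηle x ι hι htop (a := (0 : ℝ)) hPs hJs hP hJ (by rw [abs_zero]) (fun u q huq => hCr u q huq) hC1 hγ
  rw [← hsand] at h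
  exact h

/-- Non-vacuity of the scalar side of `eq324_CsDeltaCY_precision_node00_onΛ_on_unit` (same letters as p669260's `example`).
[cite: Balaban1985UV3, (24) p.262 (letters of the socket; instance ours)] -/
example :=
  eq324_CsDeltaCY_precision_node00_onΛ_on_unit (d := 3) (Fin 24) (γ₀ := 1) (BP := 1) (KJ := 1) (δ := 1) (r := 2) (m := 9) (cβ := 1) (ne := 1)
    one_pos zero_le_one zero_le_one one_pos (by norm_num) zero_le_one zero_le_one 6 4 (ϰ := 1) one_pos (p₀ := 1) (σ' := 1 / 2) (c := 1)
    (κ' := 13 / 4) (by norm_num) (by norm_num) zero_le_one (by norm_num) (by norm_num)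

end DoorOnLambda

/-! ## §3  The record editions with (R2′) on Λ-bonds only: the record fibre `M_N(ℂ)`, and NODE 00's v8 instance under small curvature -/

section DoorAtRecord

open scoped Matrix.Norms.L2Operator
open B7Prop2Explicit (unitaryUnits)
open B9Thm311ReadingCoords (trIP IsSymmTr)
open B9CoReadingCoordsTranspose (trReForm trReForm_symm sum_trReForm_eq_trIP TrIdx trBasis)
open B1Eq324BenfattoClassSectEMemberCoRead (trReForm_trBasis_eq_repr)
open B1Eq324BenfattoClassSectEMemberRealAdjointAtNode00 (abs_trReForm_trBasis_le norm_trBasis_le selfAdjoint_QG1Qinv_of_isSymmTr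
  selfAdjoint_aY_add_D2J_of_isSymmTr sum_trReForm_elimCΛY_ofRecordTC lettersYOfRecordV4_QG1Qinv_isSymmTr)
open B8Lemma1NonAbelian (pairTop)

/-- ★★★ **THE DOOR AT THE RECORD FIBRE `M_N(ℂ)` WITH (R2′) ON Λ-BONDS ONLY AND A PRINT-UNIT SCALE `λ`** — p673452 `eq324_CsDeltaCY_precision_ofRecordTC_trBasis_on_unit`
VERBATIM except that the letters are read as `λ(QG₁Q*)⁻¹`, `λ(a + ⟨D̃⁽²⁾·,J⟩)`, `λ·C*Δ_kC` and the two kernel readings are asked for `u, v ∈ Λ` only ((R1′) in `IsSymmTr 1` currency, (R3′) replaced by unitarity + pivot units, frame constants 1, (R5′) in `trIP 1`, (R4′)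
verbatim). [cite: Balaban1985BackgroundPropagators, (3.132) p.422, (3.155)–(3.158) pp.427–428, Thm 3.11 p.416, p.391; Balaban1985UV3, (24) p.262, pp.271–272;
Balaban1982Higgs1, (3.24) p.616; BenfattoEtAl1978, Lemma (4.5)–(4.7) p.152 (class form; bent window, presentation and coordinates ours)] -/
theorem eq324_CsDeltaCY_precision_ofRecordTC_trBasis_onΛ_on_unit (N : ℕ) [NeZero N] {γ₀ BP KJ δ r m : ℝ}
    (hγ₀ : 0 < γ₀) (hBP : 0 ≤ BP) (hKJ : 0 ≤ KJ) (hδ : 0 < δ) (hm : 0 ≤ m) (t D : ℕ) {ϰ : ℝ} (hϰ : 0 < ϰ)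
    {p₀ σ' c κ' : ℝ} (hp₀ : 2 / 3 < p₀) (hσ : 0 < σ') (hc : 0 ≤ c) (hκ : 0 < κ') (hκσ : κ' < σ' * (t + 1)) :
    ∃ b₁ : ℝ, ∀ b₀ : ℝ, b₁ < b₀ → ∃ C : ℝ, 0 ≤ C ∧ ∀ η : ℝ, 0 < η → η ≤ 1 →
      ∀ {ℓ : ℕ} {hd : 1 ≤ d + 1} {hL : Odd (ℓ + 1) ∧ 1 < ℓ + 1} {w₀ w₁ : ℝ} {Mstar : ℕ} (x : MemberY d ℓ hd hL w₀ w₁ Mstar)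
        [DecidableEq (IBondY x.toKIdx)]
        (𝔏 : CovLettersY (Matrix (Fin N) (Fin N) ℂ) x) (𝔳 : AvY (Matrix (Fin N) (Fin N) ℂ) x) (𝔢₀ : SectELettersY (Matrix (Fin N) (Fin N) ℂ) x)
        (U : CfgY (Matrix (Fin N) (Fin N) ℂ) x.toKIdx) (lam : ℝ)
      {σ : Type} [Fintype σ] [DecidableEq σ] [Nonempty σ] (ι : σ → IBondY x.toKIdx), Function.Injective ι → (∀ s, lamTY x (ι s)) →
        IsSymmTr (fun _ => (1 : ℝ)) (𝔏.QG1Qinv U) →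
        IsSymmTr (fun _ => (1 : ℝ)) (𝔢₀.D2J U) →
        (∀ u v : IBondY x.toKIdx, inΛY x u → inΛY x v →
          (⨆ E : BallY (Matrix (Fin N) (Fin N) ℂ), ‖((lam : ℂ) • 𝔏.QG1Qinv U) (deltaY v (E : Matrix (Fin N) (Fin N) ℂ)) u‖) ≤
            BP * Real.exp (-(δ * unitDistY x u v))) →
        (∀ (u v : IBondY x.toKIdx) (E : Matrix (Fin N) (Fin N) ℂ), inΛY x u → inΛY x v →
          ‖(((lam : ℂ) • (aY x.toKIdx + 𝔢₀.D2J U)).restrictScalars ℝ) (Pi.single v E) u‖ ≤ KJ * ‖E‖ * Real.exp (-(δ * unitDistY x u v))) →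
        (∀ b : UBondY x, ((𝔳 U b : (Matrix (Fin N) (Fin N) ℂ)ˣ) : Matrix (Fin N) (Fin N) ℂ) ∈ unitary (Matrix (Fin N) (Fin N) ℂ)) →
        (∀ c' : CBondY x, IsUnit (KY x 𝔳 U c')) → (∀ c' : CBondY x, IsUnit (KTY x 𝔳 U c')) →
        (∀ (s : σ) (w : Matrix (Fin N) (Fin N) ℂ) (u : IBondY x.toKIdx),
          elimCΛY x (sectELettersYOfRecordTC x 𝔳 𝔢₀) U (Pi.single (ι s) w) u ≠ 0 → unitDistY x u (ι s) ≤ r) →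
        (∀ (s : σ) (c' : TrIdx N), ∑ u, ‖elimCΛY x (sectELettersYOfRecordTC x 𝔳 𝔢₀) U (Pi.single (ι s) (trBasis N c')) u‖ ≤ m) →
        (∀ Φ : IBondY x.toKIdx → Matrix (Fin N) (Fin N) ℂ, (∀ u, u ∉ Set.range ι → Φ u = 0) →
          γ₀ * trIP (fun _ => (1 : ℝ)) Φ Φ ≤ trIP (fun _ => (1 : ℝ)) Φ (((lam : ℂ) • CsDeltaCY x 𝔏 (sectELettersYOfRecordTC x 𝔳 𝔢₀) U) Φ)) →
      ∃ (Λ : Finset (B1Eq324BenfattoLemma.Site (d + 1 + (d + 1) + 1))) (e' : σ × TrIdx N ≃ ↥Λ),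
        ((gaussianFieldOfKernel fun u w => if h : u ∈ Λ ∧ w ∈ Λ then
            ((Matrix.reindex e' e'
              (Matrix.of fun p q : σ × TrIdx N =>
                  trReForm (trBasis N p.2) ((((lam : ℂ) • CsDeltaCY x 𝔏 (sectELettersYOfRecordTC x 𝔳 𝔢₀) U).restrictScalars ℝ)
                    (Pi.single (ι q.1) (trBasis N q.2)) (ι p.1))))⁻¹ :
                Matrix ↥Λ ↥Λ ℝ) ⟨u, h.1⟩ ⟨w, h.2⟩ else 0).map
            (fun (z : B1Eq324BenfattoLemma.Site (d + 1 + (d + 1) + 1) → ℝ) (q : σ × TrIdx N) => z ((e' q : ↥Λ) : B1Eq324BenfattoLemma.Site (d + 1 + (d + 1) + 1))) =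
          gaussianFieldOfKernel fun p q =>
            ((Matrix.of fun p q : σ × TrIdx N =>
                trReForm (trBasis N p.2) ((((lam : ℂ) • CsDeltaCY x 𝔏 (sectELettersYOfRecordTC x 𝔳 𝔢₀) U).restrictScalars ℝ)
                  (Pi.single (ι q.1) (trBasis N q.2)) (ι p.1)))⁻¹ :
              Matrix (σ × TrIdx N) (σ × TrIdx N) ℝ) p q) ∧
        (∀ p : ℝ, 0 ≤ p →
          ((fun (z : B1Eq324BenfattoLemma.Site (d + 1 + (d + 1) + 1) → ℝ) (q : σ × TrIdx N) => z ((e' q : ↥Λ) : B1Eq324BenfattoLemma.Site (d + 1 + (d + 1) + 1))) ⁻¹'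
              {ω : σ × TrIdx N → ℝ | ∀ q, |ω q| ≤ p}) =ᵐ[gaussianFieldOfKernel fun u w => if h : u ∈ Λ ∧ w ∈ Λ then
                ((Matrix.reindex e' e'
                  (Matrix.of fun p q : σ × TrIdx N =>
                      trReForm (trBasis N p.2) ((((lam : ℂ) • CsDeltaCY x 𝔏 (sectELettersYOfRecordTC x 𝔳 𝔢₀) U).restrictScalars ℝ)
                        (Pi.single (ι q.1) (trBasis N q.2)) (ι p.1))))⁻¹ :
                    Matrix ↥Λ ↥Λ ℝ) ⟨u, h.1⟩ ⟨w, h.2⟩ else 0]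
            smallFieldSet Λ p) ∧
        ∀ (s : ℕ) (I J : Finset (B1Eq324BenfattoLemma.Site (d + 1 + (d + 1) + 1))) (𝔞 : Coef (d + 1 + (d + 1) + 1)),
          I.Nonempty → J ⊆ I → J ⊆ Λ → coefSup s D 𝔞 J ≤ c * η ^ σ' →
          0 < ∫ z, cutoffBoltzmann (hamiltonian s D ϰ 𝔞 J) I (B10.pFun b₀ p₀ η) z ∂(gaussianFieldOfKernel fun u w => if h : u ∈ Λ ∧ w ∈ Λ then
              ((Matrix.reindex e' e'
                (Matrix.of fun p q : σ × TrIdx N =>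
                    trReForm (trBasis N p.2) ((((lam : ℂ) • CsDeltaCY x 𝔏 (sectELettersYOfRecordTC x 𝔳 𝔢₀) U).restrictScalars ℝ)
                      (Pi.single (ι q.1) (trBasis N q.2)) (ι p.1))))⁻¹ :
                  Matrix ↥Λ ↥Λ ℝ) ⟨u, h.1⟩ ⟨w, h.2⟩ else 0) ∧
            |Real.log (∫ z, cutoffBoltzmann (hamiltonian s D ϰ 𝔞 J) I (B10.pFun b₀ p₀ η) z ∂(gaussianFieldOfKernel fun u w =>
                if h : u ∈ Λ ∧ w ∈ Λ then
                  ((Matrix.reindex e' e'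
                    (Matrix.of fun p q : σ × TrIdx N =>
                        trReForm (trBasis N p.2) ((((lam : ℂ) • CsDeltaCY x 𝔏 (sectELettersYOfRecordTC x 𝔳 𝔢₀) U).restrictScalars ℝ)
                          (Pi.single (ι q.1) (trBasis N q.2)) (ι p.1))))⁻¹ :
                      Matrix ↥Λ ↥Λ ℝ) ⟨u, h.1⟩ ⟨w, h.2⟩ else 0)) -
              cumulantSum (gaussianFieldOfKernel fun u w => if h : u ∈ Λ ∧ w ∈ Λ then
                  ((Matrix.reindex e' e'
                    (Matrix.of fun p q : σ × TrIdx N =>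
                        trReForm (trBasis N p.2) ((((lam : ℂ) • CsDeltaCY x 𝔏 (sectELettersYOfRecordTC x 𝔳 𝔢₀) U).restrictScalars ℝ)
                          (Pi.single (ι q.1) (trBasis N q.2)) (ι p.1))))⁻¹ :
                      Matrix ↥Λ ↥Λ ℝ) ⟨u, h.1⟩ ⟨w, h.2⟩ else 0)
                (hamiltonian s D ϰ 𝔞 J) t| ≤ C * η ^ κ' * I.card := by
  obtain ⟨b₁, hb₁⟩ := eq324_CsDeltaCY_precision_node00_onΛ_on_unit (d := d) (TrIdx N) (cβ := 1) (ne := 1) hγ₀ hBP hKJ hδ hm zero_le_one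
    zero_le_one t D hϰ hp₀ hσ hc hκ hκσ (r := r)
  refine ⟨b₁, fun b₀ hb₀ => ?_⟩
  obtain ⟨C, hC, hE⟩ := hb₁ b₀ hb₀
  refine ⟨C, hC, ?_⟩
  intro η hη hηle ℓ hd hL w₀ w₁ Mstar x _ 𝔏 𝔳 𝔢₀ U lam σ _ _ _ ι hι hιT hPs hJs hProw hJker h𝔳 hK hKT hloc hmass hco
  exact hE η hη hηle x 𝔏 (sectELettersYOfRecordTC x 𝔳 𝔢₀) U lam trReForm trReForm_symm (trBasis N)
    (fun v c' => (trReForm_trBasis_eq_repr v c').symm) abs_trReForm_trBasis_le norm_trBasis_le ι hι hιT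
    (selfAdjoint_QG1Qinv_of_isSymmTr x 𝔏 hPs) (selfAdjoint_aY_add_D2J_of_isSymmTr x 𝔢₀ hJs) hProw hJker
    (sum_trReForm_elimCΛY_ofRecordTC x 𝔳 𝔢₀ h𝔳 hK hKT) hloc hmass
    (fun Φ hΦ _ => by rw [LinearMap.coe_restrictScalars, sum_trReForm_eq_trIP, sum_trReForm_eq_trIP]; exact hco Φ hΦ)

/-- ★★★ **THE DOOR AT NODE 00's v8 INSTANCE OF RECORD UNDER SMALL CURVATURE (3.35) WITH (R2′) ON Λ-BONDS ONLY, IN PRINT UNITS** — p673452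
`eq324_CsDeltaCY_precision_opsYOfRecordV8E_trBasis_of_plaqSmall_on_unit` VERBATIM except that the precision-type letters carry the scale
`λ_x := ((L^{x.k})⁻¹)^{d+1} = η^{d+1}` (inline; def-Y's `etaDY x` by `rfl`; the conclusion is (3.24) for print's unit-lattice `𝒩(0, 𝕄_ι(η^{d+1}C*Δ_kC)⁻¹)`) and node N06's two kernel readings — (R2′a) the (3.132) unit-ball reading of
`(QG₁Q*)⁻¹(U)` at `lettersYOfRecordV4 (resYOfC2 𝔠)`, (R2′b) the reading of `a + ⟨D̃⁽²⁾·,J⟩(U)` at `sectEYWithDt2 (resYOfC2 𝔠) 𝔡₂ 𝔢₀` — are asked between Λ-BONDS ONLY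
(top level, where (3.132)'s level prefactors are constants).  Every row about NODE 00's own letters is a theorem as there; displayed: `G ≤ U(N)`, `G`-valued `U`,
plaquette smallness of the averaged field of record on every double block, [5]'s reality of `C⁽²⁾(U)`, `D̃⁽²⁾(U)`, and node N06's rows (R2′)|_Λ, (R5′) (`γ₀`).
[cite: Balaban1985BackgroundPropagators, (3.35) p.396, (3.132) p.422, (3.156)–(3.158) p.428, Thm 3.11 p.416; Balaban1985Averaging, (55)–(58) p.27, (109) p.34, (125) p.36;
Balaban1985UV3, (24) p.262, pp.271–272; Balaban1982Higgs1, (3.24) p.616; BenfattoEtAl1978, Lemma (4.5)–(4.7) p.152 (class form; bent window, presentation and coordinates ours)] -/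
theorem eq324_CsDeltaCY_precision_opsYOfRecordV8E_trBasis_of_plaqSmall_onΛ_on_unit (N : ℕ) [NeZero N] (θ : Stage3Params) (Mstar : ℕ)
    (𝔠 : C2Y N θ Mstar) (𝔡₂ : Dt2Y N θ Mstar) (𝔢₀ : SectEY N θ Mstar) {γ₀ BP KJ δ a : ℝ} (hγ₀ : 0 < γ₀) (hBP : 0 ≤ BP) (hKJ : 0 ≤ KJ) (hδ : 0 < δ)
    (ha : 0 ≤ a) (hsmall : (((θ.ℓ₆ + 1 : ℕ) : ℝ)) ^ (θ.d₆ + 1) *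
      (2 * ((((θ.d₆ * (2 * θ.ℓ₆ + 1) : ℕ) : ℝ)) * a) * (((θ.ℓ₆ + 1 : ℕ) + (θ.d₆ + 1) * θ.ℓ₆ : ℕ) : ℝ)) < 1) (t D : ℕ) {ϰ : ℝ} (hϰ : 0 < ϰ)
    {p₀ σ' c κ' : ℝ} (hp₀ : 2 / 3 < p₀) (hσ : 0 < σ') (hc : 0 ≤ c) (hκ : 0 < κ') (hκσ : κ' < σ' * (t + 1)) :
    ∃ b₁ : ℝ, ∀ b₀ : ℝ, b₁ < b₀ → ∃ C : ℝ, 0 ≤ C ∧ ∀ η : ℝ, 0 < η → η ≤ 1 →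
      ∀ (x : MemberY θ.d₆ θ.ℓ₆ θ.hd' θ.hL' θ.b₀ θ.b₁ Mstar) [DecidableEq (IBondY x.toKIdx)]
        {G : Subgroup (Matrix (Fin N) (Fin N) ℂ)ˣ}, G ≤ unitaryUnits (Matrix (Fin N) (Fin N) ℂ) →
      ∀ (U : CfgY (Matrix (Fin N) (Fin N) ℂ) x.toKIdx), (∀ μ z, U μ z ∈ G) →
        (∀ c' : CBondY x, B8Lemma1NonAbelian.PlaqSmall (VzY x (avYOfRecord x U)) (labK x c'.1.1) (labK x c'.1.1 + pairTop (θ.ℓ₆ + 1) c'.1.2) a) →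
        (∀ A A' : FBondY x.toKIdx → Matrix (Fin N) (Fin N) ℂ, (𝔠 x).form U (star A) (star A') = star ((𝔠 x).form U A A')) →
        (∀ B B' : IBondY x.toKIdx → Matrix (Fin N) (Fin N) ℂ, (𝔡₂ x).form U (star B) (star B') = star ((𝔡₂ x).form U B B')) →
      ∀ {σ : Type} [Fintype σ] [DecidableEq σ] [Nonempty σ] (ι : σ → IBondY x.toKIdx), Function.Injective ι → (∀ s, lamTY x (ι s)) →
        (∀ u v : IBondY x.toKIdx, inΛY x u → inΛY x v →
          (⨆ E : BallY (Matrix (Fin N) (Fin N) ℂ), ‖((((((((θ.ℓ₆ + 1 : ℕ) : ℝ)) ^ x.k)⁻¹) ^ (θ.d₆ + 1) : ℝ) : ℂ) • (lettersYOfRecordV4 N θ Mstar (resYOfC2 N θ Mstar 𝔠) x).QG1Qinv U)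
              (deltaY v (E : Matrix (Fin N) (Fin N) ℂ)) u‖) ≤
            BP * Real.exp (-(δ * unitDistY x u v))) →
        (∀ (u v : IBondY x.toKIdx) (E : Matrix (Fin N) (Fin N) ℂ), inΛY x u → inΛY x v →
          ‖(((((((((θ.ℓ₆ + 1 : ℕ) : ℝ)) ^ x.k)⁻¹) ^ (θ.d₆ + 1) : ℝ) : ℂ) • (aY x.toKIdx + (sectEYWithDt2 N θ Mstar (resYOfC2 N θ Mstar 𝔠) 𝔡₂ 𝔢₀ x).D2J U)).restrictScalars ℝ)
            (Pi.single v E) u‖ ≤ KJ * ‖E‖ * Real.exp (-(δ * unitDistY x u v))) →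
        (∀ Φ : IBondY x.toKIdx → Matrix (Fin N) (Fin N) ℂ, (∀ u, u ∉ Set.range ι → Φ u = 0) →
          γ₀ * trIP (fun _ => (1 : ℝ)) Φ Φ ≤ trIP (fun _ => (1 : ℝ)) Φ (((((((((θ.ℓ₆ + 1 : ℕ) : ℝ)) ^ x.k)⁻¹) ^ (θ.d₆ + 1) : ℝ) : ℂ) • CsDeltaCY x (lettersYOfRecordV4 N θ Mstar (resYOfC2 N θ Mstar 𝔠) x)
            (sectEYOfRecordV6 N θ Mstar (sectEYWithDt2 N θ Mstar (resYOfC2 N θ Mstar 𝔠) 𝔡₂ 𝔢₀) x) U) Φ)) →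
      ∃ (Λ : Finset (B1Eq324BenfattoLemma.Site (θ.d₆ + 1 + (θ.d₆ + 1) + 1))) (e' : σ × TrIdx N ≃ ↥Λ),
        ((gaussianFieldOfKernel fun u w => if h : u ∈ Λ ∧ w ∈ Λ then
            ((Matrix.reindex e' e'
              (Matrix.of fun p q : σ × TrIdx N =>
                  trReForm (trBasis N p.2) ((((((((((θ.ℓ₆ + 1 : ℕ) : ℝ)) ^ x.k)⁻¹) ^ (θ.d₆ + 1) : ℝ) : ℂ) • CsDeltaCY x (lettersYOfRecordV4 N θ Mstar (resYOfC2 N θ Mstar 𝔠) x)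
            (sectEYOfRecordV6 N θ Mstar (sectEYWithDt2 N θ Mstar (resYOfC2 N θ Mstar 𝔠) 𝔡₂ 𝔢₀) x) U).restrictScalars ℝ)
                    (Pi.single (ι q.1) (trBasis N q.2)) (ι p.1))))⁻¹ :
                Matrix ↥Λ ↥Λ ℝ) ⟨u, h.1⟩ ⟨w, h.2⟩ else 0).map
            (fun (z : B1Eq324BenfattoLemma.Site (θ.d₆ + 1 + (θ.d₆ + 1) + 1) → ℝ) (q : σ × TrIdx N) => z ((e' q : ↥Λ) : B1Eq324BenfattoLemma.Site (θ.d₆ + 1 + (θ.d₆ + 1) + 1))) =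
          gaussianFieldOfKernel fun p q =>
            ((Matrix.of fun p q : σ × TrIdx N =>
                trReForm (trBasis N p.2) ((((((((((θ.ℓ₆ + 1 : ℕ) : ℝ)) ^ x.k)⁻¹) ^ (θ.d₆ + 1) : ℝ) : ℂ) • CsDeltaCY x (lettersYOfRecordV4 N θ Mstar (resYOfC2 N θ Mstar 𝔠) x)
            (sectEYOfRecordV6 N θ Mstar (sectEYWithDt2 N θ Mstar (resYOfC2 N θ Mstar 𝔠) 𝔡₂ 𝔢₀) x) U).restrictScalars ℝ)
                  (Pi.single (ι q.1) (trBasis N q.2)) (ι p.1)))⁻¹ :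
              Matrix (σ × TrIdx N) (σ × TrIdx N) ℝ) p q) ∧
        (∀ p : ℝ, 0 ≤ p →
          ((fun (z : B1Eq324BenfattoLemma.Site (θ.d₆ + 1 + (θ.d₆ + 1) + 1) → ℝ) (q : σ × TrIdx N) => z ((e' q : ↥Λ) : B1Eq324BenfattoLemma.Site (θ.d₆ + 1 + (θ.d₆ + 1) + 1))) ⁻¹'
              {ω : σ × TrIdx N → ℝ | ∀ q, |ω q| ≤ p}) =ᵐ[gaussianFieldOfKernel fun u w => if h : u ∈ Λ ∧ w ∈ Λ then
                ((Matrix.reindex e' e'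
                  (Matrix.of fun p q : σ × TrIdx N =>
                      trReForm (trBasis N p.2) ((((((((((θ.ℓ₆ + 1 : ℕ) : ℝ)) ^ x.k)⁻¹) ^ (θ.d₆ + 1) : ℝ) : ℂ) • CsDeltaCY x (lettersYOfRecordV4 N θ Mstar (resYOfC2 N θ Mstar 𝔠) x)
            (sectEYOfRecordV6 N θ Mstar (sectEYWithDt2 N θ Mstar (resYOfC2 N θ Mstar 𝔠) 𝔡₂ 𝔢₀) x) U).restrictScalars ℝ)
                        (Pi.single (ι q.1) (trBasis N q.2)) (ι p.1))))⁻¹ :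
                    Matrix ↥Λ ↥Λ ℝ) ⟨u, h.1⟩ ⟨w, h.2⟩ else 0]
            smallFieldSet Λ p) ∧
        ∀ (s : ℕ) (I J : Finset (B1Eq324BenfattoLemma.Site (θ.d₆ + 1 + (θ.d₆ + 1) + 1))) (𝔞 : Coef (θ.d₆ + 1 + (θ.d₆ + 1) + 1)),
          I.Nonempty → J ⊆ I → J ⊆ Λ → coefSup s D 𝔞 J ≤ c * η ^ σ' →
          0 < ∫ z, cutoffBoltzmann (hamiltonian s D ϰ 𝔞 J) I (B10.pFun b₀ p₀ η) z ∂(gaussianFieldOfKernel fun u w => if h : u ∈ Λ ∧ w ∈ Λ then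
              ((Matrix.reindex e' e'
                (Matrix.of fun p q : σ × TrIdx N =>
                    trReForm (trBasis N p.2) ((((((((((θ.ℓ₆ + 1 : ℕ) : ℝ)) ^ x.k)⁻¹) ^ (θ.d₆ + 1) : ℝ) : ℂ) • CsDeltaCY x (lettersYOfRecordV4 N θ Mstar (resYOfC2 N θ Mstar 𝔠) x)
            (sectEYOfRecordV6 N θ Mstar (sectEYWithDt2 N θ Mstar (resYOfC2 N θ Mstar 𝔠) 𝔡₂ 𝔢₀) x) U).restrictScalars ℝ)
                      (Pi.single (ι q.1) (trBasis N q.2)) (ι p.1))))⁻¹ :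
                  Matrix ↥Λ ↥Λ ℝ) ⟨u, h.1⟩ ⟨w, h.2⟩ else 0) ∧
            |Real.log (∫ z, cutoffBoltzmann (hamiltonian s D ϰ 𝔞 J) I (B10.pFun b₀ p₀ η) z ∂(gaussianFieldOfKernel fun u w =>
                if h : u ∈ Λ ∧ w ∈ Λ then
                  ((Matrix.reindex e' e'
                    (Matrix.of fun p q : σ × TrIdx N =>
                        trReForm (trBasis N p.2) ((((((((((θ.ℓ₆ + 1 : ℕ) : ℝ)) ^ x.k)⁻¹) ^ (θ.d₆ + 1) : ℝ) : ℂ) • CsDeltaCY x (lettersYOfRecordV4 N θ Mstar (resYOfC2 N θ Mstar 𝔠) x)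
            (sectEYOfRecordV6 N θ Mstar (sectEYWithDt2 N θ Mstar (resYOfC2 N θ Mstar 𝔠) 𝔡₂ 𝔢₀) x) U).restrictScalars ℝ)
                          (Pi.single (ι q.1) (trBasis N q.2)) (ι p.1))))⁻¹ :
                      Matrix ↥Λ ↥Λ ℝ) ⟨u, h.1⟩ ⟨w, h.2⟩ else 0)) -
              cumulantSum (gaussianFieldOfKernel fun u w => if h : u ∈ Λ ∧ w ∈ Λ then
                  ((Matrix.reindex e' e'
                    (Matrix.of fun p q : σ × TrIdx N =>
                        trReForm (trBasis N p.2) ((((((((((θ.ℓ₆ + 1 : ℕ) : ℝ)) ^ x.k)⁻¹) ^ (θ.d₆ + 1) : ℝ) : ℂ) • CsDeltaCY x (lettersYOfRecordV4 N θ Mstar (resYOfC2 N θ Mstar 𝔠) x)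
            (sectEYOfRecordV6 N θ Mstar (sectEYWithDt2 N θ Mstar (resYOfC2 N θ Mstar 𝔠) 𝔡₂ 𝔢₀) x) U).restrictScalars ℝ)
                          (Pi.single (ι q.1) (trBasis N q.2)) (ι p.1))))⁻¹ :
                      Matrix ↥Λ ↥Λ ℝ) ⟨u, h.1⟩ ⟨w, h.2⟩ else 0)
                (hamiltonian s D ϰ 𝔞 J) t| ≤ C * η ^ κ' * I.card := by
  have hκ0 : 0 < 1 - (((θ.ℓ₆ + 1 : ℕ) : ℝ)) ^ (θ.d₆ + 1) *
      (2 * ((((θ.d₆ * (2 * θ.ℓ₆ + 1) : ℕ) : ℝ)) * a) * (((θ.ℓ₆ + 1 : ℕ) + (θ.d₆ + 1) * θ.ℓ₆ : ℕ) : ℝ)) := sub_pos.2 hsmall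
  have hm : (0 : ℝ) ≤ (1 + (1 - (((θ.ℓ₆ + 1 : ℕ) : ℝ)) ^ (θ.d₆ + 1) *
      (2 * ((((θ.d₆ * (2 * θ.ℓ₆ + 1) : ℕ) : ℝ)) * a) * (((θ.ℓ₆ + 1 : ℕ) + (θ.d₆ + 1) * θ.ℓ₆ : ℕ) : ℝ)))⁻¹) * 1 := by
    rw [mul_one]; exact add_nonneg zero_le_one (inv_nonneg.2 hκ0.le)
  obtain ⟨b₁, hb₁⟩ := eq324_CsDeltaCY_precision_ofRecordTC_trBasis_onΛ_on_unit (d := θ.d₆) N hγ₀ hBP hKJ hδ hm t D hϰ hp₀ hσ hc hκ hκσ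
    (r := (θ.ℓ₆ : ℝ) + 2)
  refine ⟨b₁, fun b₀ hb₀ => ?_⟩
  obtain ⟨C, hC, hE⟩ := hb₁ b₀ hb₀
  refine ⟨C, hC, ?_⟩
  intro η hη hηle x _ G hG U hU hP hCr hDr σ _ _ _ ι hι hιT hProw hJker hco
  have hUu : ∀ μ z, U μ z ∈ unitaryUnits (Matrix (Fin N) (Fin N) ℂ) := fun μ z => hG (hU μ z)
  exact hE η hη hηle x (lettersYOfRecordV4 N θ Mstar (resYOfC2 N θ Mstar 𝔠) x) (avYOfRecord x)
    (sectEYWithDt2 N θ Mstar (resYOfC2 N θ Mstar 𝔠) 𝔡₂ 𝔢₀ x) U _ ι hι hιT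
    (lettersYOfRecordV4_QG1Qinv_isSymmTr θ Mstar _ hG x hU (resYOfC2_Δ2_isSymmTr_real θ Mstar 𝔠 x hUu hCr))
    (sectEYWithDt2_D2J_isSymmTr_ofC2 θ Mstar 𝔠 𝔡₂ 𝔢₀ x hUu hCr hDr) hProw hJker
    (fun b => B7Prop2Explicit.mem_unitaryUnits.mp (hG (avYOfRecord_mem x hU b)))
    (fun c' => (isUnit_KY_KTY_avYOfRecord_of_plaqSmall N θ Mstar x hG hU c' ha (hP c') hsmall).1)
    (fun c' => (isUnit_KY_KTY_avYOfRecord_of_plaqSmall N θ Mstar x hG hU c' ha (hP c') hsmall).2)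
    (B1Eq324BenfattoClassSectEMemberERowsAtNode00.local_elimC_sectEYOfRecordV6 N θ Mstar _ x U ι)
    (B1Eq324BenfattoClassSectEMemberERowsAtNode00.colMass_elimC_sectEYOfRecordV6_of_plaqSmall N θ Mstar _ x hG hU ha hP hsmall
      (fun c' => trBasis N c') norm_trBasis_le ι) hco

end DoorAtRecord

end Literature.MathematicalPhysics.QuantumFieldTheory.Balaban1983to89.B1Eq324BenfattoClassSectEMemberPrecisionDoorOnLambda
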